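import Summits.ValiantsHypothesis.ValiantsHypothesis.Theorems.DivisionGapDefs
import Summits.ValiantsHypothesis.ValiantsHypothesis.Theorems.DivisionGapPerDivisionHardStubSparseRigid

/-!
# Crux `DivisionGap.PerDivisionHard` (stmt-ValiantsHypothesis-5065), line `pair-descent-jss-endpoint` —
stub `stub_lureCutsOut`: steered weights with PM-inert lure cells cut out the placed face

`stub_lureCutsOut`: on a placed block graph `G = placedBlock eR eC` (`G(b,k) ⊕ M₀`, the defs
`BlockV`, `blockAdj`, `placedBlock`, `CutsOut` of `Theorems/DivisionGapDefs.lean`) let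
`P, Q ⊆ Fin m` be DISJOINT sets of padding indices and let the weight `w` be `W` on `G` and on the
LURE cells `(eR (pad p), eC (pad q))`, `p ∈ P`, `q ∈ Q`, and `< W` on every other cell.  Then
`CutsOut w G`: the permutations inside `G` are exactly the maximum-weight ones.

Proof.
* Every cell weighs `≤ W`, so every permutation weighs `≤ n · W`, and a permutation inside `G`
  weighs exactly `n · W` (direction "inside ⇒ maximal").
* Some permutation `σ₀` lies inside `G` (`exists_perm_mem_placedBlock` from a perfect matching of
  the label graph: `exists_blockMatching` for `k ≥ 1`, the identity matching for `k = 0`), so a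
  maximal `σ` weighs `≥ n · W`, hence every cell of `σ` weighs `W`, hence is a cell of `G` or a
  lure cell.  No cell of `σ` is a lure cell: if `σ` sends column `eC (pad q)` to row `eR (pad p)`
  (`p ∈ P`, `q ∈ Q`), look at the column `j` sent to row `eR (pad q)`; the cell `(eR (pad q), j)`
  is not a lure cell (`q ∉ P`), so it lies in `G`, and the padding row `pad q` is adjacent to the
  padding column `pad q` only, so `j = eC (pad q)`, whence `pad p = pad q` — but `p ≠ q`.
-/

noncomputable section

-- `Summit.ValiantsHypothesis.ValiantsHypothesis.…` is the tree's mandated single-conjunct layout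
-- (Sub = Summit), so the duplicated namespace component is intended.
set_option linter.dupNamespace false

namespace Summit.ValiantsHypothesis.ValiantsHypothesis.Theorems.DivisionGapPerDivisionHard

variable {b k m n : ℕ}

/-- A padding row label `pad t` is adjacent only to the padding column label `pad t`
(`pad t = Sum.inr (Sum.inr t)`). [folklore] -/
theorem lure_blockAdj_pad_iff (t : Fin m) (c : BlockV b k m) :
    blockAdj b k m (Sum.inr (Sum.inr t)) c = true ↔ c = Sum.inr (Sum.inr t) := by
  rcases c with j | ⟨i, j, s⟩ | t'
  · simp [blockAdj]
  · simp [blockAdj]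
  · simp only [blockAdj, decide_eq_true_eq, Sum.inr.injEq]
    exact eq_comm

/-- For `k = 0` the identity matching of the labels lies in `G(b,0) ⊕ M₀ = K_{b,b} ⊕ M₀`
(core `i` — core `i`, padding `t` — padding `t`; there are no internal labels). [folklore] -/
theorem lure_blockAdj_self_of_zero (hk : k = 0) (r : BlockV b k m) : blockAdj b k m r r = true := by
  subst hk
  rcases r with i | ⟨_, _, t⟩ | u
  · simp [blockAdj]
  · exact t.elim0
  · simp [blockAdj]

/-- Every placed block graph contains a permutation (a perfect matching): for `k ≥ 1` by
`exists_blockMatching`, for `k = 0` by the identity matching of the labels. [folklore] -/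
theorem lure_exists_perm_mem_placedBlock (eR eC : BlockV b k m ≃ Fin n) :
    ∃ σ : Equiv.Perm (Fin n), ∀ x, (σ x, x) ∈ placedBlock eR eC := by
  rcases Nat.eq_zero_or_pos k with hk | hk
  · exact exists_perm_mem_placedBlock eR eC (Equiv.refl _)
      fun r => lure_blockAdj_self_of_zero hk r
  · obtain ⟨g, hg⟩ := exists_blockMatching b k m hk
    exact exists_perm_mem_placedBlock eR eC g hg

/-- **`stub_lureCutsOut` — steered weights with PM-inert lure cells cut out the face.**  On a
placed `G(b,k) ⊕ M₀` let `P, Q ⊆ Fin m` be DISJOINT sets of padding indices and let `w` be a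
weight that equals `W` on the placed face and on the lure cells `(padding row p, padding column q)`,
`p ∈ P`, `q ∈ Q`, and is `< W` on every other cell.  Then `CutsOut w (placedBlock eR eC)`: every
cell weighs `≤ W`, so a permutation inside the face has the maximal weight `n · W`; conversely a
permutation of weight `n · W` uses only face cells and lure cells, and it uses NO lure cell: if
row `eR (pad p)` received column `eC (pad q)`, then row `eR (pad q)` — whose only cells of weight
`W` are its matching cell `(eR (pad q), eC (pad q))` (now taken) since `q ∉ P` — could receive no
column. [folklore] -/
theorem stub_lureCutsOut :
    ∀ (b k m n : ℕ) (eR eC : BlockV b k m ≃ Fin n) (P Q : Finset (Fin m)) (W : ℕ)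
      (w : Fin n × Fin n → ℕ), Disjoint P Q →
      (∀ e ∈ placedBlock eR eC, w e = W) →
      (∀ p ∈ P, ∀ q ∈ Q, w (eR (Sum.inr (Sum.inr p)), eC (Sum.inr (Sum.inr q))) = W) →
      (∀ e ∉ placedBlock eR eC,
        (¬ ∃ p ∈ P, ∃ q ∈ Q, e = (eR (Sum.inr (Sum.inr p)), eC (Sum.inr (Sum.inr q)))) → w e < W) →
      CutsOut w (placedBlock eR eC) := by
  intro b k m n eR eC P Q W w hPQ hG hL hlt
  -- every cell weighs at most `W`
  have hle : ∀ e, w e ≤ W := by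
    intro e
    by_cases he : e ∈ placedBlock eR eC
    · exact (hG e he).le
    · by_cases hex : ∃ p ∈ P, ∃ q ∈ Q, e = (eR (Sum.inr (Sum.inr p)), eC (Sum.inr (Sum.inr q)))
      · obtain ⟨p, hp, q, hq, rfl⟩ := hex
        exact (hL p hp q hq).le
      · exact (hlt e he hex).le
  -- so every permutation weighs at most `n · W` …
  have hsum : ∀ τ : Equiv.Perm (Fin n), ∑ x, w (τ x, x) ≤ n * W := fun τ =>
    calc ∑ x, w (τ x, x) ≤ ∑ _x : Fin n, W := Finset.sum_le_sum fun x _ => hle _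
      _ = n * W := by simp
  -- … and a permutation inside the face weighs exactly `n · W`
  have hin : ∀ τ : Equiv.Perm (Fin n), (∀ x, (τ x, x) ∈ placedBlock eR eC) →
      ∑ x, w (τ x, x) = n * W := fun τ hτ => by
    rw [Finset.sum_congr rfl fun x _ => hG _ (hτ x)]
    simp
  -- a permutation inside the face
  obtain ⟨σ₀, hσ₀⟩ := lure_exists_perm_mem_placedBlock eR eC
  intro σ
  constructor
  · intro hσ τ
    rw [hin σ hσ]
    exact hsum τ
  · intro hmax
    -- `σ` is maximal, so it weighs `n · W`, so every cell of `σ` weighs `W`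
    have hW : ∀ x, w (σ x, x) = W := by
      by_contra hno
      obtain ⟨x₀, hx₀⟩ := not_forall.mp hno
      have hlt' : ∑ x, w (σ x, x) < n * W :=
        calc ∑ x, w (σ x, x) < ∑ _x : Fin n, W :=
              Finset.sum_lt_sum (fun x _ => hle _)
                ⟨x₀, Finset.mem_univ _, lt_of_le_of_ne (hle _) hx₀⟩
          _ = n * W := by simp
      have := hmax σ₀
      rw [hin σ₀ hσ₀] at this
      omega
    -- hence every cell of `σ` outside the face is a lure cell
    have hGL : ∀ x, (σ x, x) ∉ placedBlock eR eC →
        ∃ p ∈ P, ∃ q ∈ Q, (σ x, x) = (eR (Sum.inr (Sum.inr p)), eC (Sum.inr (Sum.inr q))) := by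
      intro x hx
      by_contra h
      exact absurd (hW x) (hlt _ hx h).ne
    -- no cell of `σ` is a lure cell
    intro i₀
    by_contra hi₀
    obtain ⟨p, hp, q, hq, he⟩ := hGL i₀ hi₀
    have h1 : σ i₀ = eR (Sum.inr (Sum.inr p)) := congrArg Prod.fst he
    -- the column `j` received by the padding row `eR (pad q)`
    set j := σ.symm (eR (Sum.inr (Sum.inr q))) with hj
    have hσj : σ j = eR (Sum.inr (Sum.inr q)) := σ.apply_symm_apply _
    by_cases hjG : (σ j, j) ∈ placedBlock eR eC
    · -- a face cell in the padding row `pad q` is the matching cell `(eR (pad q), eC (pad q))`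
      have hjq : eC.symm j = Sum.inr (Sum.inr q) := by
        have := hjG
        simp only [placedBlock, Finset.mem_filter, Finset.mem_univ, true_and, hσj,
          Equiv.symm_apply_apply] at this
        exact (lure_blockAdj_pad_iff q _).mp this
      have hji : j = i₀ := by
        rw [← eC.apply_symm_apply j, hjq]
        exact (congrArg Prod.snd he).symm
      have hpq : eR (Sum.inr (Sum.inr p)) = eR (Sum.inr (Sum.inr q)) := by
        rw [← h1, ← hji, hσj]
      have : p = q := by simpa using hpq
      exact Finset.disjoint_left.mp hPQ hp (this ▸ hq)
    · -- a lure cell in the row `eR (pad q)` would force `q ∈ P`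
      obtain ⟨p', hp', q', -, he'⟩ := hGL j hjG
      have hqp : eR (Sum.inr (Sum.inr q)) = eR (Sum.inr (Sum.inr p')) :=
        hσj.symm.trans (congrArg Prod.fst he')
      have : q = p' := by simpa using hqp
      exact Finset.disjoint_left.mp hPQ hp' (this ▸ hq)

end Summit.ValiantsHypothesis.ValiantsHypothesis.Theorems.DivisionGapPerDivisionHard

end
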